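import Mathlib
import Literature.NumberTheory.LFunctions.Zhang2022.Section14Summability
import HarnessLib

/-!
# Zhang (2022) §14: the regrouping u009, the edge u010 ⇐ (14.4) + u009, and the principal-character
# bound u013 (first `≪`), kernel-checked (D15 / cone C36)

Topic `Literature/NumberTheory/LFunctions/Zhang2022` (Landau–Siegel audit tree; verdict-neutral).
Y. Zhang, *Discrete mean estimates and the Landau–Siegel zero*, arXiv:2211.02515v1 (2022)
[Zhang2022LandauSiegel] — **an unrefereed manuscript under adjudication**; this file PROVES printed
claims/inferences of §14 as typed by L3-t7 (`TypedSection14.lean`) and asserts nothing else.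

* `step14u009_holds : Step14u009` — DAG node `Z22:§14.u009` [Z22 p.77, tex L3891]: the innermost sum of
  (14.4) regrouped along `(l, D) = D₁`, `l = D₁l₁` — an exact identity of `l`-series: partition of `ℕ`
  by `gcd(l,D)`, injective reindexing, and `e(−D₁l₁p̄_{Dk}/(Dk)) = e(−l₁p̄_{D₂k}/(D₂k))` since the two
  inverses of `p` agree mod `D₂k` (`nInv_modEq_of_dvd`); the exchange of the finite `D₁D₂ = D` sum with
  the series uses absolute convergence (`Section14Summability.summable_kappa_mul_DeltaW`).
* `step14u010_of : Eq144 → Step14u009 → Step14u010` — DAG node `Z22:§14.u010` [Z22 p.77, tex L3896]: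
  "Inserting this into (14.4) and rearranging the terms we conclude …" (`(k, p) = 1` on the window:
  `Section14GaussSums.coprime_of_mem_primeWindow_of_le`), and `step14u010_of_u006b : Step14u006b →
  Step14u010`, composing with d31's `eq144_of_u008_u006b` and L3-t7's `step14u008_holds`: **u010 is
  discharged modulo the second line of u006 alone.**
* `step14u013a_holds : Step14u013a` — DAG node `Z22:§14.u013` (first `≪`) [Z22 p.78, tex L3930], with
  constant `1` and `D₀ = 3`: `|τ(ψ̄⁰_{Dk})| = |μ(Dk)| ≤ 1` (`step14p78_holds`, d31), `|ψ⁰| ≤ 1`, and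
  `‖Σ_l‖ ≤ Σ_l‖·‖`, which needs the absolute convergence of the `l`-series.

## References

* Y. Zhang, arXiv:2211.02515v1 (2022), §14 pp. 77–78, (14.4), u009–u013.
  [cite: Zhang2022LandauSiegel, §14 pp.77–78]
-/

noncomputable section

open Complex Real ComplexConjugate

namespace Literature.NumberTheory.LFunctions.Zhang2022.Typed.Sec14

open Skeleton Filter

/-! ### u009: the regrouping of the `l`-series of (14.4) along `(l, D) = D₁` -/

section U009

/-- `|e(y)| = 1`. [cite: Zhang2022LandauSiegel, §5 (5.7) p.25] -/
theorem norm_eAdd_eq_one (y : ℝ) : ‖eAdd y‖ = 1 := by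
  rw [eAdd, show (2 : ℂ) * π * I * y = ((2 * π * y : ℝ) : ℂ) * I by push_cast; ring,
    Complex.norm_exp_ofReal_mul_I]

/-- `e(y + m) = e(y)` for an integer `m`. [cite: Zhang2022LandauSiegel, §5 (5.7) p.25] -/
theorem eAdd_add_intCast (y : ℝ) (m : ℤ) : eAdd (y + m) = eAdd y := by
  rw [eAdd, eAdd]
  push_cast
  rw [mul_add, Complex.exp_add]
  have : Complex.exp (2 * π * I * (m : ℂ)) = 1 := by
    rw [show 2 * (π : ℂ) * I * (m : ℂ) = m * (2 * π * I) by ring]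
    exact Complex.exp_int_mul_two_pi_mul_I m
  rw [this, mul_one]

/-- The two modular inverses `p̄ (mod N)` and `p̄ (mod M)`, `M ∣ N`, agree modulo `M` (`(p, N) = 1`).
[cite: Zhang2022LandauSiegel, §14 u009 p.77] -/
theorem nInv_modEq_of_dvd {M N p : ℕ} [NeZero M] [NeZero N] (hMN : M ∣ N) (hp : Nat.Coprime p N) :
    nInv N p ≡ nInv M p [MOD M] := by
  have hpM : Nat.Coprime p M := Nat.Coprime.coprime_dvd_right hMN hp
  rw [← ZMod.natCast_eq_natCast_iff]
  -- both sides are inverses of `p` in `ZMod M`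
  have h1 : ((nInv N p : ℕ) : ZMod M) * (p : ZMod M) = 1 := by
    have hN : ((nInv N p : ℕ) : ZMod N) * (p : ZMod N) = 1 := by
      rw [nInv, ZMod.natCast_zmod_val, mul_comm, ZMod.coe_mul_inv_eq_one p hp]
    have := congrArg (ZMod.castHom hMN (ZMod M)) hN
    rwa [map_mul, map_natCast, map_natCast, map_one] at this
  have h2 : ((nInv M p : ℕ) : ZMod M) * (p : ZMod M) = 1 := by
    rw [nInv, ZMod.natCast_zmod_val, mul_comm, ZMod.coe_mul_inv_eq_one p hpM]
  calc ((nInv N p : ℕ) : ZMod M) = (nInv N p : ZMod M) * (((nInv M p : ℕ) : ZMod M) * (p : ZMod M)) := by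
        rw [h2, mul_one]
    _ = (nInv M p : ZMod M) * (((nInv N p : ℕ) : ZMod M) * (p : ZMod M)) := by ring
    _ = (nInv M p : ZMod M) := by rw [h1, mul_one]

/-- `gcd(D₁l₁, D₁D₂) = D₁` iff `(l₁, D₂) = 1` (`D₁ ≠ 0`). [folklore] -/
private theorem gcd_mul_eq_iff {D₁ D₂ l₁ : ℕ} (h1 : D₁ ≠ 0) :
    Nat.gcd (D₁ * l₁) (D₁ * D₂) = D₁ ↔ Nat.Coprime l₁ D₂ := by
  rw [Nat.gcd_mul_left, Nat.Coprime]
  constructor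
  · intro h; exact (mul_eq_left₀ h1).mp h
  · intro h; rw [h, mul_one]

/-- `Z22:§14.u009` DISCHARGED: **the innermost sum of (14.4) regrouped along `(l, D) = D₁`, `l = D₁l₁`**
("Assume `(k,p) = 1`. If `(l,k) = 1` and `(l,D) = D₁`, then `(k,D₁) = 1`. Thus, substituting
`(l,D) = D₁` and `l = D₁l₁`, … the innermost sum in (14.4) is equal to
`Σ_{D=D₁D₂,(D₁,k)=1} Σ_{(l₁,D₂k)=1} κ*(D₁dl₁)Δ(l₁/(D₂pk))e(−l₁p̄/(D₂k))`", p. 77): an exact identity of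
the `l`-series — partition `ℕ` by `gcd(l, D)`, reindex `l = D₁l₁` (injective), and
`e(−D₁l₁·p̄_{Dk}/(Dk)) = e(−l₁·p̄_{D₂k}/(D₂k))` because the two inverses of `p` agree modulo `D₂k`
(`nInv_modEq_of_dvd`); the exchange of `Σ_{D₁D₂=D}` with the series uses its absolute convergence
(`summable_kappa_mul_DeltaW`), the reindexing does not. [cite: Zhang2022LandauSiegel, §14 u009 p.77, tex L3891] -/
theorem step14u009_holds : Step14u009 := by
  intro B
  refine ⟨3, fun D _ χ hD hq hp p hpW κs hκ d k hd hk hkp => ?_⟩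
  have hD3 : 3 ≤ D := hD
  have hprime : p.Prime := (Finset.mem_filter.mp hpW).2
  have hDp : D < p := lt_of_mem_primeWindow hD3 hpW
  have hDne : D ≠ 0 := NeZero.ne D
  have hpD : Nat.Coprime p D :=
    (Nat.Prime.coprime_iff_not_dvd hprime).mpr fun h => by
      have := Nat.le_of_dvd (by omega) h; omega
  have hpDk : Nat.Coprime p (D * k) := Nat.Coprime.mul_right hpD hkp.symm
  haveI : NeZero (D * k) := ⟨mul_ne_zero hDne (by omega)⟩
  have hQ : (0 : ℝ) < (D : ℝ) * p * k := by
    have : (0 : ℝ) < D := by exact_mod_cast Nat.pos_of_ne_zero hDne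
    have : (0 : ℝ) < p := by exact_mod_cast hprime.pos
    have : (0 : ℝ) < k := by exact_mod_cast hk
    positivity
  -- the summand `f` and its pieces `F e`
  set f : ℕ → ℂ := fun l => if Nat.Coprime l k then
      κs (d * l) * DeltaW D ((l : ℝ) / ((D : ℝ) * p * k)) *
        eAdd (-((l : ℝ) * nInv (D * k) p / (D * k))) else 0 with hf
  set F : ℕ × ℕ → ℕ → ℂ := fun e l => if Nat.gcd l D = e.1 then f l else 0 with hF
  -- summability of `f`
  have hfs : Summable f := by
    have := summable_kappa_mul_DeltaW hD3 hκ d hQ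
      (g := fun l : ℕ => if Nat.Coprime l k then
        eAdd (-((l : ℝ) * nInv (D * k) p / (D * k))) else 0) (G := 1)
      (fun l => by
        split_ifs
        · exact (norm_eAdd_eq_one _).le
        · simp)
    refine this.congr fun l => ?_
    simp only [hf]
    split_ifs <;> ring
  have hFs : ∀ e ∈ Nat.divisorsAntidiagonal D, Summable (F e) := by
    intro e _
    refine Summable.of_norm_bounded hfs.norm (fun l => ?_)
    simp only [hF]
    split_ifs <;> simp
  -- Step 1: `f = Σ_e F e` pointwise
  have hsplit : ∀ l : ℕ, f l = ∑ e ∈ Nat.divisorsAntidiagonal D, F e l := by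
    intro l
    have hg0 : Nat.gcd l D ≠ 0 := Nat.gcd_ne_zero_right hDne
    have hmem : (Nat.gcd l D, D / Nat.gcd l D) ∈ Nat.divisorsAntidiagonal D :=
      Nat.mem_divisorsAntidiagonal.mpr ⟨Nat.mul_div_cancel' (Nat.gcd_dvd_right l D), hDne⟩
    rw [Finset.sum_eq_single_of_mem _ hmem]
    · simp only [hF, if_true]
    · intro e he hne
      simp only [hF]
      rw [if_neg]
      intro hEq
      apply hne
      obtain ⟨hmul, _⟩ := Nat.mem_divisorsAntidiagonal.mp he
      have h2 : e.2 = D / Nat.gcd l D := by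
        rw [hEq]
        have he1 : e.1 ≠ 0 := by rw [← hEq]; exact hg0
        rw [← hmul, Nat.mul_div_cancel_left _ (Nat.pos_of_ne_zero he1)]
      exact Prod.ext hEq.symm h2
  -- Step 2: exchange
  rw [show (∑' l : ℕ, f l) = ∑' l : ℕ, ∑ e ∈ Nat.divisorsAntidiagonal D, F e l from
    tsum_congr hsplit, Summable.tsum_finsetSum hFs, ← Finset.sum_filter_add_sum_filter_not
    (Nat.divisorsAntidiagonal D) (fun e => Nat.Coprime e.1 k)]
  -- the `e` with `(D₁, k) > 1` contribute nothing
  have hzero : ∑ e ∈ (Nat.divisorsAntidiagonal D).filter (fun e => ¬ Nat.Coprime e.1 k),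
      ∑' l : ℕ, F e l = 0 := by
    refine Finset.sum_eq_zero fun e he => ?_
    obtain ⟨he, hcop⟩ := Finset.mem_filter.mp he
    refine (tsum_congr fun l => ?_).trans tsum_zero
    simp only [hF, hf]
    by_cases hgcd : Nat.gcd l D = e.1
    · rw [if_pos hgcd, if_neg]
      intro hlk
      apply hcop
      rw [← hgcd]
      exact Nat.Coprime.coprime_dvd_left (Nat.gcd_dvd_left l D) hlk
    · rw [if_neg hgcd]
  rw [hzero, add_zero]
  refine Finset.sum_congr rfl fun e he => ?_
  obtain ⟨he, hek⟩ := Finset.mem_filter.mp he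
  obtain ⟨hmul, _⟩ := Nat.mem_divisorsAntidiagonal.mp he
  have he1 : e.1 ≠ 0 := by intro h; rw [h, zero_mul] at hmul; exact hDne hmul.symm
  have he2 : e.2 ≠ 0 := by intro h; rw [h, mul_zero] at hmul; exact hDne hmul.symm
  haveI : NeZero (e.2 * k) := ⟨mul_ne_zero he2 (by omega)⟩
  -- Step 3: reindex `l = e.1 * l₁`
  have hinj : Function.Injective (fun l₁ : ℕ => e.1 * l₁) := mul_right_injective₀ he1
  have hsupp : Function.support (F e) ⊆ Set.range (fun l₁ : ℕ => e.1 * l₁) := by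
    intro l hl
    rw [Function.mem_support] at hl
    simp only [hF] at hl
    by_cases hgcd : Nat.gcd l D = e.1
    · have hdvd : e.1 ∣ l := hgcd ▸ Nat.gcd_dvd_left l D
      obtain ⟨l₁, hl₁⟩ := hdvd
      exact ⟨l₁, hl₁.symm⟩
    · rw [if_neg hgcd] at hl; exact absurd rfl hl
  rw [← hinj.tsum_eq hsupp]
  -- Step 4: termwise
  refine tsum_congr fun l₁ => ?_
  simp only [hF, hf]
  have hgcd_iff : Nat.gcd (e.1 * l₁) D = e.1 ↔ Nat.Coprime l₁ e.2 := by
    rw [← hmul]; exact gcd_mul_eq_iff he1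
  by_cases hl2 : Nat.Coprime l₁ e.2
  · rw [if_pos (hgcd_iff.mpr hl2)]
    by_cases hlk : Nat.Coprime l₁ k
    · have h1 : Nat.Coprime (e.1 * l₁) k := Nat.Coprime.mul_left hek hlk
      have h2 : Nat.Coprime l₁ (e.2 * k) := Nat.Coprime.mul_right hl2 hlk
      rw [if_pos h1, if_pos h2]
      -- the three factors agree
      have hκ' : κs (d * (e.1 * l₁)) = κs (e.1 * d * l₁) := by ring_nf
      have hΔ : DeltaW D (((e.1 * l₁ : ℕ) : ℝ) / ((D : ℝ) * p * k)) =
          DeltaW D ((l₁ : ℝ) / ((e.2 : ℝ) * p * k)) := by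
        congr 1
        have hD' : (D : ℝ) = (e.1 : ℝ) * e.2 := by rw [← hmul]; push_cast; ring
        have he1' : (e.1 : ℝ) ≠ 0 := by exact_mod_cast he1
        rw [hD']; push_cast
        field_simp
      have hE : eAdd (-(((e.1 * l₁ : ℕ) : ℝ) * nInv (D * k) p / (D * k))) =
          eAdd (-((l₁ : ℝ) * nInv (e.2 * k) p / (e.2 * k))) := by
        have hdvd : e.2 * k ∣ D * k := by rw [← hmul, mul_assoc]; exact dvd_mul_left _ _
        have hmod := (nInv_modEq_of_dvd hdvd hpDk).symm.dvd
        -- `(e.2 k : ℤ) ∣ nInv (D k) p − nInv (e.2 k) p`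
        obtain ⟨m, hm⟩ := hmod
        have hm' : (nInv (D * k) p : ℝ) = nInv (e.2 * k) p + (e.2 : ℝ) * k * m := by
          have := congrArg (fun z : ℤ => (z : ℝ)) hm
          push_cast at this
          linarith
        have hD' : (D : ℝ) = (e.1 : ℝ) * e.2 := by rw [← hmul]; push_cast; ring
        have he1' : (e.1 : ℝ) ≠ 0 := by exact_mod_cast he1
        have he2' : (e.2 : ℝ) ≠ 0 := by exact_mod_cast he2
        have hk' : (k : ℝ) ≠ 0 := by exact_mod_cast (show k ≠ 0 by omega)
        have harg : -(((e.1 * l₁ : ℕ) : ℝ) * nInv (D * k) p / (D * k)) =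
            -((l₁ : ℝ) * nInv (e.2 * k) p / (e.2 * k)) + ((-(l₁ : ℤ) * m : ℤ) : ℝ) := by
          rw [hm', hD']; push_cast
          field_simp
          ring
        rw [harg, eAdd_add_intCast]
      rw [hκ', hΔ, hE]
    · have h1 : ¬ Nat.Coprime (e.1 * l₁) k := fun h => hlk (Nat.Coprime.coprime_mul_left h)
      have h2 : ¬ Nat.Coprime l₁ (e.2 * k) := fun h => hlk (Nat.Coprime.coprime_mul_left_right h)
      rw [if_neg h1, if_neg h2]
  · rw [if_neg (fun h => hl2 (hgcd_iff.mp h))]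
    have h2 : ¬ Nat.Coprime l₁ (e.2 * k) := fun h => hl2 (Nat.Coprime.coprime_mul_right_right h)
    rw [if_neg h2]

end U009

section

variable {D : ℕ} [NeZero D] (χ : DirichletCharacter ℂ D)

/-- `Z22:§14.u010` DISCHARGED as an inference: **(14.4) ∧ u009 ⇒ u010** ("Inserting this into (14.4) and
rearranging the terms we conclude", p. 77): the `l`-series of (14.4) is split by u009 along `(l,D) = D₁`
(`(k,p) = 1` on the window), and the finite sums over `d`, `k` and `D = D₁D₂` are exchanged.
[cite: Zhang2022LandauSiegel, §14 u010 p.77, tex L3896] -/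
theorem step14u010_of (h144 : Eq144) (h9 : Step14u009) : Step14u010 := by
  intro B
  obtain ⟨c, hc, C, h⟩ := h144 B
  refine ⟨c, hc, C, ?_⟩
  obtain ⟨D₀, h0⟩ := h.and (h9 B)
  obtain ⟨D₁, hD₁⟩ := exists_two_mul_P4_le_bigP
  refine ⟨max (max D₀ D₁) 3, fun D _ χ hD hq hp hA p hpW κs as hκ has => ?_⟩
  have hD0' : D₀ ≤ D := le_trans (le_trans (le_max_left _ _) (le_max_left _ _)) hD
  have hD1 : D₁ ≤ D := le_trans (le_trans (le_max_right _ _) (le_max_left _ _)) hD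
  have hD3 : 3 ≤ D := le_trans (le_max_right _ _) hD
  obtain ⟨e144, e9⟩ := h0 D χ hD0' hq hp
  have key := e144 hA p hpW κs as hκ has
  have hk : ∀ k ∈ Finset.Icc 1 ⌊2 * P4 D⌋₊, Nat.Coprime p (D * k) := fun k hkI =>
    coprime_of_mem_primeWindow_of_le hD₁ hD1 hD3 hpW hkI
  have hEq : (∑ d ∈ Finset.Icc 1 ⌊2 * P4 D⌋₊, (d : ℂ)⁻¹ * ∑ k ∈ Finset.Icc 1 ⌊2 * P4 D⌋₊,
        as (d * k) / (k : ℂ) * ∑' l : ℕ, if Nat.Coprime l k then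
          κs (d * l) * DeltaW D ((l : ℝ) / ((D : ℝ) * p * k)) *
            eAdd (-((l : ℝ) * nInv (D * k) p / (D * k))) else 0) =
      ∑ e ∈ Nat.divisorsAntidiagonal D, calS D e.1 e.2 p κs as := by
    -- insert u009
    have step : ∀ d ∈ Finset.Icc 1 ⌊2 * P4 D⌋₊, ∀ k ∈ Finset.Icc 1 ⌊2 * P4 D⌋₊,
        as (d * k) / (k : ℂ) * (∑' l : ℕ, if Nat.Coprime l k then
          κs (d * l) * DeltaW D ((l : ℝ) / ((D : ℝ) * p * k)) *
            eAdd (-((l : ℝ) * nInv (D * k) p / (D * k))) else 0) =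
        ∑ e ∈ Nat.divisorsAntidiagonal D, if Nat.Coprime k e.1 then
          as (d * k) / (k : ℂ) * ∑' l₁ : ℕ, if Nat.Coprime l₁ (e.2 * k) then
            κs (e.1 * d * l₁) * DeltaW D ((l₁ : ℝ) / ((e.2 : ℝ) * p * k)) *
              eAdd (-((l₁ : ℝ) * nInv (e.2 * k) p / (e.2 * k))) else 0 else 0 := by
      intro d hd k hkI
      have hd1 : 1 ≤ d := (Finset.mem_Icc.mp hd).1
      have hk1 : 1 ≤ k := (Finset.mem_Icc.mp hkI).1
      have hkp : Nat.Coprime k p := ((hk k hkI).coprime_mul_left_right).symm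
      rw [e9 p hpW κs hκ d k hd1 hk1 hkp, Finset.mul_sum, Finset.sum_filter]
      refine Finset.sum_congr rfl fun e _ => ?_
      simp only [Nat.coprime_comm (m := k)]
    rw [Finset.sum_congr rfl fun d hd => by
      rw [Finset.sum_congr rfl fun k hk => step d hd k hk, Finset.sum_comm, Finset.mul_sum]]
    rw [Finset.sum_comm]
    simp only [calS, Finset.sum_filter]
  rw [hEq] at key
  exact key


/-- `Z22:§14.u010` modulo u006 alone: **u006 (second line) ⇒ u010**, composing d31's
`eq144_of_u008_u006b`, L3-t7's `step14u008_holds`, `step14u009_holds` and `step14u010_of`.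
[cite: Zhang2022LandauSiegel, §14 u010 p.77, tex L3896] -/
theorem step14u010_of_u006b (h6 : Step14u006b) : Step14u010 :=
  step14u010_of (eq144_of_u008_u006b step14u008_holds h6) step14u009_holds

/-- `Z22:§14.u013` (first `≪`) DISCHARGED with constant `1`: **the `θ = ψ⁰` term of (14.7) is bounded by
the majorant of u013** (`|τ(ψ̄⁰_{Dk})| = |μ(Dk)| ≤ 1`, `|ψ⁰| ≤ 1`, and the `l`-series converges absolutely).
[cite: Zhang2022LandauSiegel, §14 u013 p.78, tex L3930] -/
theorem step14u013a_holds : Step14u013a := by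
  intro B
  refine ⟨1, 3, fun D _ χ hD hq hp p hpW κs as hκ has => ?_⟩
  have hD3 : 3 ≤ D := hD
  have hprime : p.Prime := (Finset.mem_filter.mp hpW).2
  rw [one_mul, princ147, major1413]
  refine (norm_sum_le _ _).trans (Finset.sum_le_sum fun d _ => ?_)
  rw [norm_mul, norm_inv, Complex.norm_natCast]
  refine mul_le_mul_of_nonneg_left ?_ (by positivity)
  refine (norm_sum_le _ _).trans (Finset.sum_le_sum fun k hk => ?_)
  have hk1 : 1 ≤ k := (Finset.mem_Icc.mp hk).1
  have hDk : 0 < D * k := Nat.mul_pos (Nat.pos_of_ne_zero (NeZero.ne D)) hk1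
  have hQ : (0 : ℝ) < (D : ℝ) * p * k := by
    have : (0 : ℝ) < D := by exact_mod_cast Nat.pos_of_ne_zero (NeZero.ne D)
    have : (0 : ℝ) < p := by exact_mod_cast hprime.pos
    have : (0 : ℝ) < k := by exact_mod_cast hk1
    positivity
  -- the summable pieces
  have hs1 := summable_kappa_mul_DeltaW hD3 hκ d hQ
    (g := fun l : ℕ => (1 : DirichletCharacter ℂ (D * k)) (-(l : ZMod (D * k)))) (G := 1)
    (fun l => DirichletCharacter.norm_le_one _ _)
  have hs2 := (summable_kappa_mul_DeltaW hD3 hκ d hQ (g := fun _ : ℕ => (1 : ℂ)) (G := 1)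
    (fun l => by simp)).norm
  have hs2' : Summable fun l : ℕ => ‖κs (d * l)‖ * ‖DeltaW D ((l : ℝ) / ((D : ℝ) * p * k))‖ := by
    refine hs2.congr fun l => ?_
    simp only [norm_mul, mul_one]
  -- |τ(ψ̄⁰)| ≤ 1, |ψ̄⁰(p)| ≤ 1
  have hτ : ‖tauSum (D * k) (1 : DirichletCharacter ℂ (D * k))⁻¹‖ ≤ 1 := by
    rw [step14p78_holds (D * k) hDk, Complex.norm_intCast]
    exact_mod_cast ArithmeticFunction.abs_moebius_le_one
  have h1p : ‖(1 : DirichletCharacter ℂ (D * k))⁻¹ (p : ZMod (D * k))‖ ≤ 1 :=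
    DirichletCharacter.norm_le_one _ _
  rw [norm_mul, norm_mul, norm_mul, norm_div, norm_mul, Complex.norm_natCast, Complex.norm_natCast]
  -- the series
  have hser : ‖∑' l : ℕ, κs (d * l) * (1 : DirichletCharacter ℂ (D * k)) (-(l : ZMod (D * k))) *
      DeltaW D ((l : ℝ) / ((D : ℝ) * p * k))‖ ≤
      ∑' l : ℕ, ‖κs (d * l)‖ * ‖DeltaW D ((l : ℝ) / ((D : ℝ) * p * k))‖ := by
    refine (norm_tsum_le_tsum_norm hs1.norm).trans (Summable.tsum_le_tsum (fun l => ?_) hs1.norm hs2')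
    rw [norm_mul, norm_mul]
    calc ‖κs (d * l)‖ * ‖(1 : DirichletCharacter ℂ (D * k)) (-(l : ZMod (D * k)))‖ *
          ‖DeltaW D ((l : ℝ) / ((D : ℝ) * p * k))‖
        ≤ ‖κs (d * l)‖ * 1 * ‖DeltaW D ((l : ℝ) / ((D : ℝ) * p * k))‖ := by
          gcongr; exact DirichletCharacter.norm_le_one _ _
      _ = _ := by rw [mul_one]
  have hrhs : ∑' l : ℕ, ‖κs (d * l) * as (d * k)‖ / ((Nat.totient (D * k) : ℝ) * k) *
        ‖DeltaW D ((l : ℝ) / ((D : ℝ) * p * k))‖ =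
      ‖as (d * k)‖ / ((k : ℝ) * Nat.totient (D * k)) *
        ∑' l : ℕ, ‖κs (d * l)‖ * ‖DeltaW D ((l : ℝ) / ((D : ℝ) * p * k))‖ := by
    rw [← tsum_mul_left]
    refine tsum_congr fun l => ?_
    rw [norm_mul]; ring
  rw [hrhs]
  have hw : 0 ≤ ‖as (d * k)‖ / ((k : ℝ) * Nat.totient (D * k)) := by positivity
  have hS : 0 ≤ ∑' l : ℕ, ‖κs (d * l)‖ * ‖DeltaW D ((l : ℝ) / ((D : ℝ) * p * k))‖ :=
    tsum_nonneg fun l => by positivity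
  calc ‖as (d * k)‖ / ((k : ℝ) * Nat.totient (D * k)) *
        (‖tauSum (D * k) (1 : DirichletCharacter ℂ (D * k))⁻¹‖ *
          ‖(1 : DirichletCharacter ℂ (D * k))⁻¹ (p : ZMod (D * k))‖ *
          ‖∑' l : ℕ, κs (d * l) * (1 : DirichletCharacter ℂ (D * k)) (-(l : ZMod (D * k))) *
            DeltaW D ((l : ℝ) / ((D : ℝ) * p * k))‖)
      ≤ ‖as (d * k)‖ / ((k : ℝ) * Nat.totient (D * k)) *
        (1 * 1 * ∑' l : ℕ, ‖κs (d * l)‖ * ‖DeltaW D ((l : ℝ) / ((D : ℝ) * p * k))‖) := by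
        gcongr
    _ = _ := by rw [one_mul, one_mul]


end

end Literature.NumberTheory.LFunctions.Zhang2022.Typed.Sec14
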